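import Mathlib
import Summits.PneNP.PneNP.Theses.OneSlice
import Literature.Computability.Complexity.Rossman2008
import Literature.Computability.Complexity.RossmanMonotoneClique
import Literature.Computability.Complexity.NegationLimited

/-!
# Sketch — crux-ideate stmt-PneNP-2832 (`OneSlice.SliceTarget`), ideator 1, round 1

First lemmas and transfer targets of the two idea cards
`upsprinkle-two-thresholds` (card A) and `star-rewiring-self-correction` (card B).
Statements only (`sorry` allowed here; nothing is proposed from this file).
-/

namespace Summit.PneNP.PneNP.Cruxes.SliceTarget.Sketch

open Literature.Computability.Complexity Finset Filter Classical

noncomputable section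

/-- Edge positions of `K_n`. -/
abbrev E (n : ℕ) : Type := ((⊤ : SimpleGraph (Fin n)).edgeSet)

/-- Critical density `p_c = n^{-2/(k-1)}`. -/
def pc (n k : ℕ) : ℝ := (n : ℝ) ^ (-(2 : ℝ) / ((k : ℝ) - 1))

/-- `G(n,q)`-error of `C` against `CLIQUE_k`. -/
def errAt (n k : ℕ) (q : ℝ) (C : Circuit (E n)) : ℝ :=
  gnpProb n q (univ.filter fun x => C.eval x ≠ cliqueFn n k x)

/-! ## Card A — up-sprinkling collapses the threshold axis for circuits with ≥ 1 negation -/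

/-- General (fan-in-2, complete basis) single threshold: the product-measure form of X. -/
def GenSingleThreshold : Prop :=
  ∀ c : ℕ, ∃ k : ℕ, 3 ≤ k ∧ ∃ δ : ℝ, 0 < δ ∧ ∀ᶠ n : ℕ in atTop, ∀ C : Circuit (E n),
    C.IsOver B2 → errAt n k (pc n k) C ≤ δ → n ^ c < C.size

/-- Transfer target A⁺: accuracy at EVERY density `q ≤ p_c` (a continuum of thresholds). -/
def GenAllSubcritical : Prop :=
  ∀ c : ℕ, ∃ k : ℕ, 3 ≤ k ∧ ∃ δ : ℝ, 0 < δ ∧ ∀ᶠ n : ℕ in atTop, ∀ C : Circuit (E n),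
    C.IsOver B2 → (∀ q : ℝ, 0 ≤ q → q ≤ pc n k → errAt n k q C ≤ δ) → n ^ c < C.size

/-- Rossman's Theorem 2 with the word "monotone" deleted (weak-exponent form):
accuracy at the two densities `p_c - p_c^{1+ε}` and `p_c`. -/
def GenTwoThresholds : Prop :=
  ∀ c : ℕ, ∃ k : ℕ, 3 ≤ k ∧ ∃ ε : ℝ, 0 < ε ∧ ∃ δ : ℝ, 0 < δ ∧ ∀ᶠ n : ℕ in atTop,
    ∀ C : Circuit (E n), C.IsOver B2 →
      errAt n k (pc n k - pc n k ^ (1 + ε)) C ≤ δ → errAt n k (pc n k) C ≤ δ → n ^ c < C.size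

/-- The negation ladder at two thresholds: De Morgan circuits with at most `b n` NOT gates.
`b = 0` is Rossman 2010 Thm 2 (known); `b = 1` already implies `OneSlice.SingleThreshold`
(up-sprinkle + one-negation count splice); `b n = ⌈log₂(C(n,2)+1)⌉` is X (Markov–Fischer). -/
def NegBudgetTwoThresholds (b : ℕ → ℕ) : Prop :=
  ∀ c : ℕ, ∃ k : ℕ, 3 ≤ k ∧ ∃ ε : ℝ, 0 < ε ∧ ∃ δ : ℝ, 0 < δ ∧ ∀ᶠ n : ℕ in atTop,
    ∀ C : Circuit (E n), C.IsOver deMorganBasis → C.negationCount ≤ b n →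
      errAt n k (pc n k - pc n k ^ (1 + ε)) C ≤ δ → errAt n k (pc n k) C ≤ δ → n ^ c < C.size

/-- **First lemma (card A): superposition of independent sprinkles.** For `x ∼ G(n,q)` and an
independent `z ∼ G(n,r)`, the union `x ∨ z` is distributed as `G(n, q + r - qr)` — pointwise:
the total `(q,r)`-weight of the pairs `(x,z)` with `x ∨ z = G` is the `(q + r - qr)`-weight of `G`.
This is the measure identity behind up-sprinkling `C'(x) := MAJ_t C(x ∨ Z_t)`. -/
theorem superpose_gnpWeight (n : ℕ) (q r : ℝ) (G : E n → Bool) :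
    (∑ x : E n → Bool, ∑ z : E n → Bool,
        if (fun e => x e || z e) = G then gnpWeight n q x * gnpWeight n r z else 0) =
      gnpWeight n (q + r - q * r) G := by
  sorry

/-- Shape of the up-sprinkle step (card A, to become `stub_upsprinkle`): a circuit accurate at
`p_c` yields, for `q = p_c - p_c^{1+ε}`, a circuit with ONE MORE layer of negation budget
(`T` copies + one negated edge-count threshold) accurate at both `q` and `p_c`. Stated for the
monotone base case, where it shows `NegBudgetTwoThresholds 1 → OneSlice.SingleThreshold`. -/
def UpSprinkleMonotone : Prop :=
  ∀ k : ℕ, 3 ≤ k → ∀ ε : ℝ, 0 < ε → ε < 1 → ∀ δ : ℝ, 0 < δ → ∃ T a : ℕ, ∀ᶠ n : ℕ in atTop,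
    ∀ C : Circuit (E n), C.IsOver monotoneBasis → errAt n k (pc n k) C ≤ δ →
      ∃ C' : Circuit (E n), C'.IsOver deMorganBasis ∧ C'.negationCount ≤ 1 ∧
        C'.size ≤ T * C.size + n ^ a ∧
        errAt n k (pc n k) C' ≤ 4 * δ ∧ errAt n k (pc n k - pc n k ^ (1 + ε)) C' ≤ 4 * δ

/-! ## Card B — star rewiring: exactly slice-uniform queries, decision → search → local -/

/-- The star of `v`: edge positions containing `v`. -/
def star (n : ℕ) (v : Fin n) : Finset (E n) := univ.filter fun e => v ∈ (e : Sym2 (Fin n))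

/-- Rewire the star of `v` in `G` to the star pattern `S` (keep `G` off the star). -/
def rewire {n : ℕ} (v : Fin n) (G S : E n → Bool) : E n → Bool :=
  fun e => if v ∈ (e : Sym2 (Fin n)) then S e else G e

/-- **First lemma (card B): star rewiring preserves the uniform slice measure exactly.**
For every target `G''` with `j` edges, the number of pairs `(G, S)` — `G` on slice `j`, `S` a
star pattern at `v` (supported on `star v`) with as many edges as `G` has at `v` — that rewire
to `G''` is `C(n-1, deg_{G''}(v))`, independently of `G''`. Hence if `G` is uniform on the slice
and `S` is a uniform star of size `deg_G(v)`, `rewire v G S` is again uniform on the slice, and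
`(G, rewire v G S)` is an exchangeable pair: `G` is a uniform point of its own `v`-fibre. -/
theorem card_rewire_fibre (n j : ℕ) (v : Fin n) (G'' : E n → Bool) (hG : edgeCount G'' = j) :
    #(univ.filter fun p : (E n → Bool) × (E n → Bool) =>
        edgeCount p.1 = j ∧ (∀ e, p.2 e = true → e ∈ star n v) ∧
        #(univ.filter fun e => p.2 e = true) = #((star n v).filter fun e => p.1 e = true) ∧
        rewire v p.1 p.2 = G'') =
      (n - 1).choose #((star n v).filter fun e => G'' e = true) := by
  sorry

/-- Transfer target B: SEARCH at criticality. A finder is a map from graphs to `k`-sets computed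
bitwise by circuits; success = the output is a `k`-clique of the input, measured on the slice
conditioned on `ω_k ≥ 1`. `SearchX`: for every `c` some `k` and `σ < 1` such that every finder of
total size `≤ n^c` succeeds on less than a `σ`-fraction of the critical slice graphs with a clique. -/
def SearchX : Prop :=
  ∀ c : ℕ, ∃ k : ℕ, 3 ≤ k ∧ ∃ σ : ℝ, σ < 1 ∧ ∀ᶠ n : ℕ in atTop, ∀ j : ℕ,
    |(j : ℝ) - (⌊((n.choose 2 : ℕ) : ℝ) * pc n k⌋₊ : ℝ)| ≤ (⌊((n.choose 2 : ℕ) : ℝ) * pc n k⌋₊ : ℝ) ^ ((3 : ℝ) / 4) →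
    ∀ F : Fin n → Circuit (E n), (∀ v, (F v).IsOver B2) → (∑ v, (F v).size) ≤ n ^ c →
      ((#(univ.filter fun x : E n → Bool => edgeCount x = j ∧ cliqueFn n k x = true ∧
          (SimpleGraph.fromEdgeSet {e : Sym2 (Fin n) | ∃ h : e ∈ (⊤ : SimpleGraph (Fin n)).edgeSet,
              x ⟨e, h⟩ = true}).IsNClique k (univ.filter fun v => (F v).eval x = true)) : ℝ)) <
        σ * #(univ.filter fun x : E n → Bool => edgeCount x = j ∧ cliqueFn n k x = true)

/-- The self-correction lemma (card B, to become `stub_selfCorrect`): a `δ`-accurate decider on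
all central slices yields a finder of polynomial overhead succeeding on all but `A_k · δ^{1/2}` of
the critical graphs with a clique (queries: `T` independent star rewirings per vertex, majority,
then read the clique off the surviving vertices; derandomised by averaging). Informal shape only:
`SliceTargetDeciderSmall → FinderSmall`; with it, `SearchX ↔ SliceTarget`. -/
def SelfCorrection : Prop :=
  ∀ k : ℕ, 3 ≤ k → ∃ A : ℝ, ∃ T a : ℕ, ∀ δ : ℝ, 0 < δ → ∀ᶠ n : ℕ in atTop,
    ∀ C : Circuit (E n), C.IsOver B2 →
      (∀ j : ℕ, |(j : ℝ) - (⌊((n.choose 2 : ℕ) : ℝ) * pc n k⌋₊ : ℝ)| ≤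
          (⌊((n.choose 2 : ℕ) : ℝ) * pc n k⌋₊ : ℝ) ^ ((3 : ℝ) / 4) →
        (#(univ.filter fun x : E n → Bool => edgeCount x = j ∧ C.eval x ≠ cliqueFn n k x) : ℝ) ≤
          δ * #(univ.filter fun x : E n → Bool => edgeCount x = j)) →
      ∃ F : Fin n → Circuit (E n), (∀ v, (F v).IsOver B2) ∧ (∑ v, (F v).size) ≤ T * n * C.size + n ^ a ∧
        ∀ j : ℕ, |(j : ℝ) - (⌊((n.choose 2 : ℕ) : ℝ) * pc n k⌋₊ : ℝ)| ≤
            (⌊((n.choose 2 : ℕ) : ℝ) * pc n k⌋₊ : ℝ) ^ ((3 : ℝ) / 4) →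
          (1 - A * Real.sqrt δ) * #(univ.filter fun x : E n → Bool => edgeCount x = j ∧ cliqueFn n k x = true) ≤
            #(univ.filter fun x : E n → Bool => edgeCount x = j ∧ cliqueFn n k x = true ∧
              (SimpleGraph.fromEdgeSet {e : Sym2 (Fin n) | ∃ h : e ∈ (⊤ : SimpleGraph (Fin n)).edgeSet,
                  x ⟨e, h⟩ = true}).IsNClique k (univ.filter fun v => (F v).eval x = true))

end

end Summit.PneNP.PneNP.Cruxes.SliceTarget.Sketch
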